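import Summits.BirchSwinnertonDyer.BirchSwinnertonDyer.Theses.CMKolyvaginAtInertTwo
import Summits.BirchSwinnertonDyer.BirchSwinnertonDyer.Theorems.CMKolyvaginAtInertTwoCMExactDescentAtTwoLocal
import Summits.BirchSwinnertonDyer.Rank1Residual.AdditivePotMult.ModelFreeClassTheorems
import Summits.BirchSwinnertonDyer.Rank1Residual.P2.HeegnerIndexAtTwoOverK
import Summits.BirchSwinnertonDyer.Rank1Residual.X11b.Three.KolyvaginLine
import Summits.BirchSwinnertonDyer.Uniform.U2.RingClassNoTwoTorsion
import Literature.NumberTheory.EllipticCurves.BSDSelmerPConverseYanZhuKolyvaginSystemProofs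
import Literature.NumberTheory.EllipticCurves.HeegnerPointsOfConductorOneGaloisConjProofs
import Literature.NumberTheory.EllipticCurves.HeegnerPointsClassesProofs
import Literature.NumberTheory.EllipticCurves.BSDHeegnerPointsGrossZagierProofs
import Literature.NumberTheory.EllipticCurves.TwoAdicImageSurjectivityModTwoProofs
import Literature.NumberTheory.EllipticCurves.GrossZagierRationalPoint
import Literature.NumberTheory.EllipticCurves.AnalyticRankOrderProofs
import Literature.NumberTheory.EllipticCurves.LFunctionSmulProofs
import Literature.NumberTheory.QuadraticFields.QuadraticDedekindZeta
import Literature.NumberTheory.QuadraticFields.ImaginaryResiduePiForm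
import HarnessLib

/-!
# Route `CMKolyvaginAtInertTwo` (rung W-ALL/12.K12-2), crux `CMExactDescentAtTwo`
# (item stmt-BirchSwinnertonDyer-22837): the EXACT `2`-adic descent `#Ш(E/K)[2^∞] = 4^{M₀} ∧
# BSD₂(E^{(d_K)}) ⟹ BSD₂(E)`, PROVED in the kernel modulo the four published named facts it consumes

HONEST FRAMING (cell `bsd-print-cf2`, HOME `run/shared/lean/pub/bsd-print-cf2/`, seat
`bsd-line-cmk2-p1`; line `route-BirchSwinnertonDyer-CMKolyvaginAtInertTwo` on the registered leaf
`WAllCornerFTwo`): THEOREMS ONLY — no definition, no named fact, nothing asserted, nothing booked;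
BSD is not proved by this and no class of the CM corner at `2` is closed here (the exactness
`#Ш(E/K)[2^∞] = 4^{M₀}` is the INPUT — item 22836's research claim). The crux is typed WITHOUT
named-fact antecedents, while every kernel road to it consumes four STATEMENT-ONLY published facts
(DOSSIER §21.3): Gross–Zagier (`gross_zagier`; GZ86 Thm I.6.3 / Cai–Shu–Tian 2014 Thm 1.1),
Gross–Zagier–Kolyvagin over `ℚ` (`rank_eq_analyticRank_of_analyticRank_le_one`), modularity
(`hasEntireLFunction_rat`, the route's support item `EntireLFunctionRat`) and Milne 1972 Thm 1 in
Dokchitser–Dokchitser's any-model form (`Milne1972.bsdQuotient_baseChange_quadratic_anyModel`). This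
file proves **`cmExactDescentAtTwo_of_facts : GZ → GZK → modularity → Milne → CMExactDescentAtTwo`**
and the bundled twin `cmExactDescentAtTwo_ofFacts` (the cell's `…OfFacts` shape): a CONDITIONAL
closer (D-0014), landed `--supports`; the by-name closure needs an `…OfFacts` twin item. The CM
hypotheses of the item (`HasCM`, `CMInert W 2`) are NOT used.

The argument (Gross–Zagier V.§2 over `K`, exact at `2`; DOSSIER §21 K1–K7), `V = W ⊗ K`:
(§2) `P(1) = Tr y(1)` descends to `P₀ ∈ E(K)` over the Heegner point of THE ITEM'S datum `Dt`
(Gross 1991 §4; reciprocity at conductor `1`, tree theorem `heegnerPointOfConductor_one_galoisConj_holds`);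
(§3) `E(K[1])[2] = 0` (tree theorem `Uniform.U2.RingClass.forall_two_nsmul_eq_zero_of_heegner`), so
`2^M ∣ P(1)` in `E(K[1])` iff `2^M ∣ P₀` in `E(K)` (`Koly.pDiv_one_iff_exists_zsmul_eq`) and
`ord₂ [E(K):ℤP₀] = M₀` (`Koly.padicValNat_index_zmultiples_eq_of_divisibility`);
(§4) `#Ш_an(V) = 4·I²/(c²·w_K²·(∏_ℓ c_ℓ)²)` EXACTLY in Dokchitser–Dokchitser's currency
(`AdditivePotMult.shaAnOverC`), from Gross–Zagier, `2‖ω‖²/√|d_K| = Ω(V)`, rank `E(K) = 1`,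
`#tors²·ĥ(P₀) = I²·Reg(V)` and `C(V) = (∏ c_ℓ)²` (this seat's `…Local` file: `V` is globally
minimal over `K`) — no Kolyvagin binder (rank/finiteness over `K` from GZK for `E`, `E^{(d_K)}`);
(§5) `w_K = 2`, `c`, `∏c_ℓ` odd ⟹ `ord₂ #Ш_an(V) = 2M₀ = ord₂ #Ш(V)`, i.e. `MissingPPartOverCAt V 2`;
`r_an(E^{(d_K)}) = 0` as `L′(E/K,1) = L′(E,1)·L(E^{(d_K)},1) ≠ 0`; the model-free descent
`AdditivePotMult.bsdp_of_pPartOverC_baseChange` (Milne: all stray `2`-powers of the item's «why it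
might fail» cancel inside one whole-quotient identity; Kramer 1981 never enters) gives `BSD₂(W)`.

References: [GrossZagier1986] I.(6.3), V.§2; [GrossLMS1991] §1 (1.2), §2 Conj. (2.2), §4 (4.1);
[McCallumLMS1991] §5 Lemma 5.1; [CaiShuTian2014] Thm 1.1; [Milne1972ArithmeticAV] §1 Thm 1;
[DokchitserDokchitserAnnals2010] §1, §2.1; [Miller2011LMS] Def. 1.1; cell DOSSIER §20.2, §21.
-/


set_option autoImplicit false
-- the Theorems namespace of this sub repeats the summit name by design (D-0017 nested layout)
set_option linter.dupNamespace false

noncomputable section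

open scoped Classical

open WeierstrassCurve NumberField Literature.NumberTheory.EllipticCurves
  Literature.NumberTheory.EllipticCurves.ModularForms
  Literature.NumberTheory.EllipticCurves.Rank1Residual
  Literature.NumberTheory.EllipticCurves.Rank1Residual.Typed
  Literature.NumberTheory.EllipticCurves.KrizLi2019
  Summit.BirchSwinnertonDyer.Rank1Residual
  Summit.BirchSwinnertonDyer.Rank1Residual.AdditivePotMult

namespace Summit.BirchSwinnertonDyer.BirchSwinnertonDyer.Theorems.CMExactDescent

/-! ## §1 The Heegner field: `d_K ≡ 1 (mod 4)`, `d_K < −4`, `w_K = 2` -/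

/-- An imaginary quadratic field with odd discriminant `≠ −3` has `d_K ≡ 1 (mod 4)` and `d_K < −4`
(Stickelberger: `d_K ≡ 0, 1 (mod 4)`; `d_K < 0`; the only odd discriminant in `[−4, 0)` is `−3`).
[folklore] -/
theorem discr_emod_four_and_lt_of_odd {K : Type} [Field K] [NumberField K] (hK : IsImaginaryQuadratic K)
    (hodd : Odd (NumberField.discr K)) (h3 : NumberField.discr K ≠ -3) :
    NumberField.discr K % 4 = 1 ∧ NumberField.discr K < -4 := by
  have h4 := Literature.NumberTheory.QuadraticFields.Quadratic.discr_emod_four_eq_one hK.1 hodd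
  have hneg : NumberField.discr K < 0 := hK.discr_neg
  refine ⟨h4, ?_⟩
  omega

/-! ## §2 The Heegner point of the item's datum `Dt` below `P(1)` -/

/-- **`P(1) = Tr_{K[1]/K} y(1)` descends to `P₀ ∈ E(K)` over the Heegner point `∑_{[Q]} φ(τ_Q)` of
THE SAME datum `Dt`** (Gross 1991 §4 «`P_1 = y_K`»; Darmon 2004 Thm. 3.7): Galois descent (tree
`heegnerSystem_exists_isHeegnerPoint_map_eq_derivedPoint_one`, whose `IsHeegnerPoint` hides the datum),
a Heegner datum `H` with `H.β = β` (`exists_heegnerDatum`) and Shimura reciprocity at conductor `1`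
(`heegnerPointOfConductor_one_galoisConj_holds`). [cite: GrossLMS1991, §4 (4.1) (P_1 = y_K)]
[cite: Darmon2004, Thm. 3.7] -/
theorem exists_heegnerPoint_map_eq_derivedPoint_one {N : ℕ} [NeZero N] {W : WeierstrassCurve ℚ}
    [W.IsElliptic] {K : Type} [Field K] [NumberField K] {Dt : ModularParametrizationData W N}
    {β : ℤ} {ι : K →+* ℂ} (hK : IsImaginaryQuadratic K) (hH : SatisfiesHeegnerHypothesis N K)
    (d : KolyvaginHeegnerData Dt β ι 1) :
    ∃ (P₀ : (W.baseChange K).toAffine.Point) (H : HeegnerDatum N (NumberField.discr K)),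
      WeierstrassCurve.Affine.Point.map ι.toRatAlgHom P₀ = heegnerPointComplex Dt H ∧
      WeierstrassCurve.Affine.Point.map (W' := W) (algebraMap K (ringClassField K ι 1)).toRatAlgHom P₀ =
        d.derivedPoint := by
  obtain ⟨P₀, -, hP₀⟩ := heegnerSystem_exists_isHeegnerPoint_map_eq_derivedPoint_one
    (heegnerPointOfConductor_one_galoisConj_holds N W K) hK hH d
  obtain ⟨H, hHβ⟩ := exists_heegnerDatum N hK.discr_neg d.dvd_sq_sub
  obtain ⟨e, he⟩ := (heegnerPointOfConductor_one_galoisConj_holds N W K) hK hH Dt β ι d H hHβ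
  refine ⟨P₀, H, ?_, hP₀⟩
  have hι : ι.toRatAlgHom = (ringClassField K ι 1).subtype.toRatAlgHom.comp
      (algebraMap K (ringClassField K ι 1)).toRatAlgHom := by
    ext x
    rfl
  rw [hι, ← WeierstrassCurve.Affine.Point.map_map, hP₀, d.derivedPoint_one, map_sum,
    heegnerPointComplex, ← Finset.sum_coe_sort H.reps, ← Finset.sum_coe_sort d.S]
  exact Fintype.sum_equiv e _ _ fun s ↦ he s

/-! ## §3 No `2`-power torsion over `K[1]` and `K`; the index of `P₀` is `2^{M₀}` up to odd -/

section NoTorsion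

variable (W : WeierstrassCurve ℚ) [W.IsElliptic] [W.IsGloballyMinimal]
  {K : Type} [Field K] [NumberField K] (hK : IsImaginaryQuadratic K)

include hK in
/-- **`E(K[1])[2^M] = 0`** for `W` globally minimal with `ρ̄_{E,2}` onto and a Heegner field `K` of
odd discriminant: no rational `2`-torsion (`forall_two_nsmul_of_hasSurjectiveModNGaloisRep_two`), no
`2`-torsion over `K[1]` (`Uniform.U2.RingClass.forall_two_nsmul_eq_zero_of_heegner`), induction on `M`.
[cite: GrossLMS1991, §4 Lemma 4.3 (shape; here at p = 2)] -/
theorem eq_zero_of_two_pow_smul_eq_zero_ringClassField (hodd : Odd (NumberField.discr K))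
    (hH : SatisfiesHeegnerHypothesis (W.conductorNorm ℤ) K) (hρ : W.HasSurjectiveModNGaloisRep 2)
    (ι : K →+* ℂ) (M : ℕ) (R : (W.baseChange (ringClassField K ι 1)).toAffine.Point)
    (hR : ((2 ^ M : ℕ) : ℤ) • R = 0) : R = 0 := by
  haveI := (finiteDimensional_and_isGalois_ringClassField hK ι one_ne_zero).1
  haveI : NumberField (ringClassField K ι 1) := NumberField.of_module_finite K _
  have hD4 : NumberField.discr K % 4 = 1 :=
    Literature.NumberTheory.QuadraticFields.Quadratic.discr_emod_four_eq_one hK.1 hodd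
  -- the group law on `E(ℚ)` is stated with two (equal) `DecidableEq ℚ` instances in the two files
  have hT : ∀ P : W.toAffine.Point, 2 • P = 0 → P = 0 := by
    intro P hP
    have h := DokchitserDokchitser2012.forall_two_nsmul_of_hasSurjectiveModNGaloisRep_two W
      two_ne_zero hρ P (by convert hP)
    convert h
  have h1 : ∀ Q : (W.baseChange (ringClassField K ι 1 : Type)).toAffine.Point, (2 : ℕ) • Q = 0 → Q = 0 :=
    fun Q hQ ↦ Uniform.U2.RingClass.forall_two_nsmul_eq_zero_of_heegner W hK ι hD4 hH hT one_ne_zero Q hQ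
  induction M generalizing R with
  | zero => simpa using hR
  | succ M ih =>
    have h2 : (2 : ℕ) • (((2 ^ M : ℕ) : ℤ) • R) = 0 := by
      rw [← natCast_zsmul, smul_smul, ← Nat.cast_mul, ← pow_succ', hR]
    have h3 := h1 _ h2
    exact ih R h3

include hK in
/-- **`E(K)[2] = 0`** under the same hypotheses (`E(K) ⊆ E(K[1])`). [folklore] -/
theorem eq_zero_of_two_smul_eq_zero_baseChange (hodd : Odd (NumberField.discr K))
    (hH : SatisfiesHeegnerHypothesis (W.conductorNorm ℤ) K) (hρ : W.HasSurjectiveModNGaloisRep 2)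
    (R : (W.baseChange K).toAffine.Point) (hR : 2 • R = 0) : R = 0 := by
  obtain ⟨v⟩ : Nonempty (InfinitePlace K) := inferInstance
  let ι : K →+* ℂ := v.embedding
  set f : (W.baseChange K).toAffine.Point →+ (W.baseChange (ringClassField K ι 1)).toAffine.Point :=
    WeierstrassCurve.Affine.Point.map (W' := W) (algebraMap K (ringClassField K ι 1)).toRatAlgHom
    with hf
  have hfinj : Function.Injective f :=
    WeierstrassCurve.Affine.Point.map_injective (W' := W) (algebraMap K (ringClassField K ι 1)).toRatAlgHom
  apply hfinj
  rw [map_zero]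
  refine eq_zero_of_two_pow_smul_eq_zero_ringClassField W hK hodd hH hρ ι 1 (f R) ?_
  rw [pow_one, show ((2 : ℕ) : ℤ) • f R = (2 : ℕ) • f R from natCast_zsmul _ _, ← map_nsmul, hR,
    map_zero]

end NoTorsion

/-! ## §4 The exact Gross–Zagier identity over `K` on the model `W ⊗ K`, model-free currency -/

/-- **`#Ш_an(W ⊗ K) = 4·[E(K):ℤP]² / (c² · w_K² · (∏_ℓ c_ℓ(E))²)` EXACTLY, no Kolyvagin binder.**
`W/ℚ` globally minimal of conductor `N`; `K` imaginary quadratic, every `ℓ ∣ N` split; `Dt` a datum at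
level `N` (`Dt.c ≠ 0`); `P ∈ E(K)` over the Heegner point of `(Dt, H)`; `ord_{s=1} L(E_K, s) = 1`;
binders `hGZ` (Gross–Zagier), `hGZK`, `hmod`. CONCLUSION: `rank E(K) = 1`, `Ш(E_K)` finite, `P`
non-torsion, and Dokchitser–Dokchitser's `#Ш_an` of the model `W ⊗ K` (`AdditivePotMult.shaAnOverC`)
is the displayed rational (sub-lane «bsd-p2»'s `P2.shaAnOver_baseChange_eq_heegnerIndex_sq_of_caiShuTian`
with Gross–Zagier for Cai–Shu–Tian and `C(W ⊗ K) = (∏ c_ℓ)²`, `modifiedTamagawaProduct_baseChange_eq_sq_of_heegner`).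
[cite: GrossZagier1986, Thm. I.6.3 and V.(2.1)–(2.2) (pp. 310–312)] [cite: GrossLMS1991, §1 (1.2) and §2 Conj. (2.2)] -/
theorem shaAnOverC_baseChange_eq_of_heegner
    (W : WeierstrassCurve ℚ) [W.IsElliptic] [W.IsGloballyMinimal] [NeZero (W.conductorNorm ℤ)]
    (K : Type) [Field K] [NumberField K]
    (Dt : ModularParametrizationData W (W.conductorNorm ℤ))
    (H : HeegnerDatum (W.conductorNorm ℤ) (NumberField.discr K)) (ι : K →+* ℂ)
    (P : (W.baseChange K).toAffine.Point)
    (hGZ : gross_zagier (W.conductorNorm ℤ) W K)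
    (hGZK : rank_eq_analyticRank_of_analyticRank_le_one) (hmod : hasEntireLFunction_rat)
    (hK : IsImaginaryQuadratic K) (hH : SatisfiesHeegnerHypothesis (W.conductorNorm ℤ) K)
    (hP : WeierstrassCurve.Affine.Point.map ι.toRatAlgHom P = heegnerPointComplex Dt H)
    (hc0 : Dt.c ≠ 0) (hr : (W.baseChange K).analyticRank = 1) :
    (W.baseChange K).mordellWeilRank = 1 ∧ (W.baseChange K).ShaFinite ∧ ¬ IsOfFinAddOrder P ∧
      shaAnOverC (W.baseChange K) =
        ((4 * ((AddSubgroup.zmultiples P).index : ℚ) ^ 2 /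
          ((Dt.c : ℚ) ^ 2 * (Units.torsionOrder K : ℚ) ^ 2 * ((W.tamagawaProduct : ℚ) ^ 2)) : ℚ) : ℂ) := by
  haveI hEK : (W.baseChange K).IsElliptic := isElliptic_baseChange' W K
  obtain ⟨h2, hKtc⟩ := hK
  haveI : IsTotallyComplex K := hKtc
  have hD0 : (NumberField.discr K : ℚ) ≠ 0 := by exact_mod_cast NumberField.discr_ne_zero K
  haveI hEt : (W.quadraticTwist (NumberField.discr K : ℚ)).IsElliptic :=
    W.isElliptic_quadraticTwist hD0
  obtain ⟨hlead, hLK⟩ := P2.leadingLCoeff_baseChange_eq_lDerivEK W K hmod h2 hr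
  have hLD := (hGZ ⟨h2, hKtc⟩ hH) Dt H ι P hP
  have hPinf : ¬ IsOfFinAddOrder P := by
    intro hfin
    apply hLK
    rw [hLD, (Affine.Point.canonicalHeight_eq_zero_iff_holds P).mpr hfin]
    simp
  -- ranks and finiteness over `K` from GZK for `E` and `E^{(d_K)}` (no Kolyvagin binder)
  have hranks := (P2.analyticRank_baseChange_eq_one_iff W K hmod h2).mp hr
  have hrW : W.analyticRank ≤ 1 := by rcases hranks with ⟨h, -⟩ | ⟨h, -⟩ <;> omega
  have hrt : (W.quadraticTwist (NumberField.discr K : ℚ)).analyticRank ≤ 1 := by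
    rcases hranks with ⟨-, h⟩ | ⟨-, h⟩ <;> omega
  obtain ⟨hrankW, hfinW⟩ := hGZK W hrW
  obtain ⟨hrankt, hfint⟩ := hGZK (W.quadraticTwist (NumberField.discr K : ℚ)) hrt
  have hrkK : (W.baseChange K).mordellWeilRank = 1 := by
    rw [mordellWeilRank_baseChange_quadratic_holds W K h2, hrankW, hrankt]
    rcases hranks with ⟨h, h'⟩ | ⟨h, h'⟩ <;> omega
  have hShaK : (W.baseChange K).ShaFinite :=
    Literature.NumberTheory.EllipticCurves.shaFinite_baseChange_of_shaFinite W K h2 hfinW hfint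
  refine ⟨hrkK, hShaK, hPinf, ?_⟩
  have hheight :=
    P2.torsionOrder_sq_mul_canonicalHeight_eq_index_sq_mul_regulator (W.baseChange K) hrkK P hPinf
  have hper := two_mul_covolume_div_sqrt_eq_bsdPeriod W K Dt h2
  have hCsq := modifiedTamagawaProduct_baseChange_eq_sq_of_heegner W K h2 hH
  have hB : 0 < (W.baseChange K).bsdPeriod := bsdPeriod_pos' _
  have hR : 0 < (W.baseChange K).regulator := (W.baseChange K).regulator_pos'
  have hcW : 0 < W.tamagawaProduct := W.tamagawaProduct_pos_holds
  have htK : 0 < (W.baseChange K).torsionOrder := (W.baseChange K).torsionOrder_pos_holds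
  have hw : 0 < Units.torsionOrder K := Units.torsionOrder_pos K
  set I := (AddSubgroup.zmultiples P).index with hI_def
  set B := (W.baseChange K).bsdPeriod with hB_def
  set R := (W.baseChange K).regulator with hR_def
  set hh := P.canonicalHeight with hhh_def
  set tK := (W.baseChange K).torsionOrder with htK_def
  set cW := W.tamagawaProduct with hcW_def
  set w := Units.torsionOrder K with hw_def
  set cM := Dt.c with hcM_def
  set q : ℚ := 4 * (I : ℚ) ^ 2 / ((cM : ℚ) ^ 2 * (w : ℚ) ^ 2 * ((cW : ℚ) ^ 2)) with hq_def
  show shaAnOverC (W.baseChange K) = (q : ℂ)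
  -- the Gross–Zagier constant is `4 B / (c² w²)`
  have hGZc : 2 * ZLattice.covolume Dt.L.lattice /
        ((cM : ℝ) ^ 2 * ((w : ℝ) / 2) ^ 2 * √|(NumberField.discr K : ℝ)|) =
      4 * B / ((cM : ℝ) ^ 2 * (w : ℝ) ^ 2) := by
    rw [← hper]; field_simp; ring
  set X : ℝ := 4 * B / ((cM : ℝ) ^ 2 * (w : ℝ) ^ 2) * hh with hX_def
  have hL1 : (W.baseChange K).leadingLCoeff = ((X : ℝ) : ℂ) := by
    rw [hlead, hLD, hGZc]
  have hsha : shaAnOverC (W.baseChange K) =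
      ((X * (tK : ℝ) ^ 2 / (B * ((cW : ℝ) ^ 2) * R) : ℝ) : ℂ) := by
    rw [shaAnOverC, hCsq, hL1]
    push_cast
    ring
  have hXq : X * (tK : ℝ) ^ 2 / (B * ((cW : ℝ) ^ 2) * R) = (q : ℝ) := by
    have htK' : (tK : ℝ) ≠ 0 := by exact_mod_cast htK.ne'
    have hcW' : (cW : ℝ) ≠ 0 := by exact_mod_cast hcW.ne'
    have hcM' : (cM : ℝ) ≠ 0 := by exact_mod_cast hc0
    have hw' : (w : ℝ) ≠ 0 := by exact_mod_cast hw.ne'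
    have hhI : hh = (I : ℝ) ^ 2 * R / (tK : ℝ) ^ 2 := by
      rw [← hheight]; field_simp
    rw [hX_def, hhI, hq_def]
    push_cast
    field_simp
  rw [hsha, hXq]
  norm_cast

/-! ## §5 The crux, closed modulo the four published facts -/

/-- **`CMExactDescentAtTwo` MODULO ITS FOUR PUBLISHED INPUTS** `hGZ` (Gross–Zagier, all `(N, W, K)`),
`hGZK` (Gross–Zagier–Kolyvagin over `ℚ`), `hmod` (modularity), `hMilneC` (Milne 1972 Thm 1, any
model): §2–§4 give `MissingPPartOverCAt (W ⊗ K) 2` — `ord₂ (4I²/(c²·w_K²·(∏c_ℓ)²)) = 2·ord₂ I = 2M₀ =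
ord₂ #Ш(E_K/K)` (`w_K = 2`; `c`, `∏c_ℓ` odd; `ord₂ I = M₀`) — and `r_an(E^{(d_K)}) = 0`
(`L′(E/K,1) = L′(E,1)·L(E^{(d_K)},1) ≠ 0`); `AdditivePotMult.bsdp_of_pPartOverC_baseChange` concludes
`BSD(W, 2)`. The CM hypotheses and the optimality display of `Dt` are not used. CONDITIONAL on the four
named facts (none has a `_holds`); closes item 22837 only through an `…OfFacts` twin.
[cite: GrossZagier1986, V.§2 (pp. 310–312)] [cite: Milne1972ArithmeticAV, §1 Thm. 1]
[cite: McCallumLMS1991, §5 Lemma 5.1] [cite: Miller2011LMS, Def. 1.1] -/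
theorem cmExactDescentAtTwo_of_facts
    (hGZ : ∀ (N : ℕ) [NeZero N] (W : WeierstrassCurve ℚ) (K : Type) [Field K] [NumberField K],
      gross_zagier N W K)
    (hGZK : rank_eq_analyticRank_of_analyticRank_le_one) (hmod : hasEntireLFunction_rat)
    (hMilneC : Milne1972.bsdQuotient_baseChange_quadratic_anyModel) :
    Summit.BirchSwinnertonDyer.BirchSwinnertonDyer.Theses.CMKolyvaginAtInertTwo.CMExactDescentAtTwo := by
  intro W _ _ _ _hcm _hin hρ hr hT K _ _ hK hodd h3 hH Dt _hopt hc β ι d₁ hy M₀ hdiv hndiv hsha Wd _ _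
    hWd hBd
  haveI : Fact (Nat.Prime 2) := ⟨Nat.prime_two⟩
  haveI hEK : (W.baseChange K).IsElliptic := isElliptic_baseChange' W K
  have h2 : Module.finrank ℚ K = 2 := hK.1
  have hD0 : (NumberField.discr K : ℚ) ≠ 0 := by exact_mod_cast NumberField.discr_ne_zero K
  haveI hEt : (W.quadraticTwist (NumberField.discr K : ℚ)).IsElliptic :=
    W.isElliptic_quadraticTwist hD0
  obtain ⟨hD4, hDlt⟩ := discr_emod_four_and_lt_of_odd hK hodd h3
  have hw2 : Units.torsionOrder K = 2 :=
    Literature.NumberTheory.QuadraticFields.Quadratic.torsionOrder_eq_two_of_discr_lt_neg_four h2 hDlt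
  have hc0 : Dt.c ≠ 0 := by
    obtain ⟨k, hk⟩ := hc
    omega
  -- §2: the Heegner point `P₀ ∈ E(K)` below `P(1)`, for the item's own `Dt`
  obtain ⟨P₀, Hd, hP₀, hP₀K⟩ := exists_heegnerPoint_map_eq_derivedPoint_one hK hH d₁
  have hPinf : ¬ IsOfFinAddOrder P₀ := by
    intro hfin
    apply hy
    rw [← hP₀K]
    exact (WeierstrassCurve.Affine.Point.map (W' := W)
      (algebraMap K (ringClassField K ι 1)).toRatAlgHom).isOfFinAddOrder hfin
  -- the twin has analytic rank `0`: `L′(E/K,1) = L′(E,1) · L(E^{(d_K)},1) ≠ 0`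
  have hLK : LDerivEK W K ≠ 0 :=
    (lDerivEK_ne_zero_iff_not_isOfFinAddOrder W (W.conductorNorm ℤ) K (hGZ _ W K) hK hH
      ⟨Dt, Hd, ι, hP₀⟩).mpr hPinf
  have hL0 : W.entireLFunction 1 = 0 := entireLFunction_one_eq_zero_of_analyticRank_eq_one hr
  have hLt : (W.quadraticTwist (NumberField.discr K : ℚ)).entireLFunction 1 ≠ 0 := by
    intro h0
    apply hLK
    rw [lDerivEK_eq_deriv_mul W K hmod hL0, h0, mul_zero]
  have hrt : (W.quadraticTwist (NumberField.discr K : ℚ)).analyticRank = 0 :=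
    ((W.quadraticTwist _).analyticRank_eq_zero_iff_holds (hmod _)).mpr hLt
  have hrd : Wd.analyticRank = 0 := by
    obtain ⟨Cd, hCd⟩ := hWd
    rw [← hCd, analyticRank_smul, hrt]
  have hrK : (W.baseChange K).analyticRank = 1 :=
    (P2.analyticRank_baseChange_eq_one_iff W K hmod h2).mpr (Or.inl ⟨hr, hrt⟩)
  -- §4: the exact identity over `K`
  obtain ⟨hrkK, hShaK, -, hshaC⟩ := shaAnOverC_baseChange_eq_of_heegner W K Dt Hd ι P₀ (hGZ _ W K)
    hGZK hmod hK hH hP₀ hc0 hrK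
  haveI hfinK : Finite (W.baseChange K).sha := hShaK
  -- §3: `ord₂ [E(K) : ℤP₀] = M₀`
  have htor1 : ∀ (M : ℕ) (R : (W.baseChange (ringClassField K ι 1)).toAffine.Point),
      ((2 ^ M : ℕ) : ℤ) • R = 0 → R = 0 :=
    fun M R hR ↦ eq_zero_of_two_pow_smul_eq_zero_ringClassField W hK hodd hH hρ ι M R hR
  have hdivK : ∃ Q : (W.baseChange K).toAffine.Point, ((2 ^ M₀ : ℕ) : ℤ) • Q = P₀ :=
    (X11b.Three.Koly.pDiv_one_iff_exists_zsmul_eq hK d₁ P₀ hP₀K 2 M₀ (htor1 M₀)).mp hdiv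
  have hndivK : ¬ ∃ Q : (W.baseChange K).toAffine.Point, ((2 ^ (M₀ + 1) : ℕ) : ℤ) • Q = P₀ :=
    fun h ↦ hndiv ((X11b.Three.Koly.pDiv_one_iff_exists_zsmul_eq hK d₁ P₀ hP₀K 2 (M₀ + 1)
      (htor1 (M₀ + 1))).mpr h)
  have hiv : ∀ x : (W.baseChange K).toAffine.Point, 2 • x = 0 → x = 0 :=
    fun x hx ↦ eq_zero_of_two_smul_eq_zero_baseChange W hK hodd hH hρ x hx
  haveI : Finite (AddCommGroup.torsion (W.baseChange K).toAffine.Point) :=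
    WeierstrassCurve.finite_torsion_point (W := W.baseChange K)
  obtain ⟨cc, Q, hcQ, hcker⟩ :=
    X11b.RankOne.exists_coord_of_mordellWeilRank_eq_one (W.baseChange K) hrkK
  have hidx : padicValNat 2 (AddSubgroup.zmultiples P₀).index = M₀ :=
    X11b.Three.Koly.padicValNat_index_zmultiples_eq_of_divisibility (p := 2) cc Q hcQ hcker hiv P₀
      hdivK hndivK
  -- §5: `ord₂ #Ш_an(W ⊗ K) = 2 M₀ = ord₂ #Ш(W ⊗ K)`
  set I := (AddSubgroup.zmultiples P₀).index with hI_def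
  have hI0 : I ≠ 0 := fun hI ↦ by
    have hh := P2.torsionOrder_sq_mul_canonicalHeight_eq_index_sq_mul_regulator (W.baseChange K)
      hrkK P₀ hPinf
    rw [← hI_def, hI, Nat.cast_zero, zero_pow two_ne_zero, zero_mul, mul_eq_zero,
      pow_eq_zero_iff two_ne_zero, Nat.cast_eq_zero] at hh
    exact hh.elim (W.baseChange K).torsionOrder_pos_holds.ne'
      (fun h0 ↦ hPinf ((Affine.Point.canonicalHeight_eq_zero_iff_holds P₀).mp h0))
  set q : ℚ := 4 * (I : ℚ) ^ 2 /
      ((Dt.c : ℚ) ^ 2 * (Units.torsionOrder K : ℚ) ^ 2 * ((W.tamagawaProduct : ℚ) ^ 2)) with hq_def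
  have hcQ0 : (Dt.c : ℚ) ≠ 0 := by exact_mod_cast hc0
  have hcW0 : (W.tamagawaProduct : ℚ) ≠ 0 := by exact_mod_cast W.tamagawaProduct_pos_holds.ne'
  have hIQ0 : (I : ℚ) ≠ 0 := by exact_mod_cast hI0
  have hq' : q = ((I : ℚ) / ((Dt.c : ℚ) * (W.tamagawaProduct : ℚ))) ^ 2 := by
    rw [hq_def, hw2]
    push_cast
    field_simp
    ring
  have hvc : padicValRat 2 (Dt.c : ℚ) = 0 := by
    rw [padicValRat.of_int, padicValInt.eq_zero_of_not_dvd (fun h2c ↦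
      (Int.not_even_iff_odd.mpr hc) (even_iff_two_dvd.mpr h2c))]
    rfl
  have hvcW : padicValRat 2 (W.tamagawaProduct : ℚ) = 0 := by
    rw [padicValRat.of_nat, padicValNat.eq_zero_of_not_dvd hT.not_two_dvd_nat]
    rfl
  have hval : padicValRat 2 q = 2 * (M₀ : ℤ) := by
    rw [hq', padicValRat.pow, padicValRat.div hIQ0 (mul_ne_zero hcQ0 hcW0),
      padicValRat.mul hcQ0 hcW0, hvc, hvcW, padicValRat.of_nat, hidx]
    push_cast
    ring
  have hshaV : padicValNat 2 (W.baseChange K).shaOrder = 2 * M₀ := by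
    rw [X11b.Three.Koly.padicValNat_shaOrder_eq (W.baseChange K) 2, hsha, padicValNat.prime_pow]
  have hKin : MissingPPartOverCAt (W.baseChange K) 2 := ⟨q, hshaC, by rw [hval, hshaV]; push_cast; ring⟩
  exact bsdp_of_pPartOverC_baseChange W 2 K Wd hGZK hmod hMilneC hr.le h2 hWd
    (by rw [hrd]; exact zero_le_one) hKin hBd

/-- **The crux RELATIVE TO its named-fact bundle** (the cell's `…OfFacts` shape, PrintCf2 20362/20363
precedent; DOSSIER §21.3): `(∀ N W K, gross_zagier N W K) ∧ GZK ∧ modularity ∧ Milne any-model →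
CMExactDescentAtTwo` — the statement a by-name closer can prove. [cite: Miller2011LMS, Def. 1.1] -/
theorem cmExactDescentAtTwo_ofFacts :
    ((∀ (N : ℕ) [NeZero N] (W : WeierstrassCurve ℚ) (K : Type) [Field K] [NumberField K],
        gross_zagier N W K) ∧
      rank_eq_analyticRank_of_analyticRank_le_one ∧ hasEntireLFunction_rat ∧
      Milne1972.bsdQuotient_baseChange_quadratic_anyModel) →
    Summit.BirchSwinnertonDyer.BirchSwinnertonDyer.Theses.CMKolyvaginAtInertTwo.CMExactDescentAtTwo :=
  fun h ↦ cmExactDescentAtTwo_of_facts h.1 h.2.1 h.2.2.1 h.2.2.2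

end Summit.BirchSwinnertonDyer.BirchSwinnertonDyer.Theorems.CMExactDescent

end
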